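import Mathlib
import Summits.Ventures.PercRepro2.SortedPairsCode

/-!
# Sorted labellings of four pairs of points, II: the orbit minimum is sorted (blind cell PercRepro2, night-3, 2026-08-24)

Swapping a misoriented pair (`code8_swapAt_lt_k`) or exchanging two misordered consecutive pairs
(`code8_exch_lt_k`) lowers the code of the eight endpoint labels; hence the member of least code
in the orbit of a list of four pairs under pair permutations and end swaps (`act`) is SORTED
(`exists_sorted`) — the coverage lemma of a fully symmetry-reduced enumeration of the typed-edge
labellings.
-/

namespace Summit.Ventures.PercRepro2

open UnionCluster

namespace CovForm

namespace TwoTyped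

open OneTyped

section Sorted

open Classical

variable {V : Type*} {E : Type*} (ends : E → Sym2 V) (o a₁ a₂ a₃ b : V) (ω : Config E)

/-- Swapping the ends of pair `0` changes no point before index `5`. -/
lemma pt_swapAt_0 (ps : Fin 4 → V × V) (j : ℕ) (hj : j ≤ 4) :
    pt o a₁ a₂ a₃ b (xsOf (swapAt ps 0)) j = pt o a₁ a₂ a₃ b (xsOf ps) j := by
  interval_cases j <;> rfl

/-- **Swapping a misoriented pair lowers the code**: if the first end of pair `0` carries the
larger label, the swapped list has a smaller code. -/
lemma code8_swapAt_lt_0 (ps : Fin 4 → V × V)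
    (h : lab ends o a₁ a₂ a₃ b (xsOf ps) ω 6 < lab ends o a₁ a₂ a₃ b (xsOf ps) ω 5) :
    code8 ends o a₁ a₂ a₃ b ω (xsOf (swapAt ps 0)) < code8 ends o a₁ a₂ a₃ b ω (xsOf ps) := by
  have hpre : ∀ j ≤ 4, pt o a₁ a₂ a₃ b (xsOf (swapAt ps 0)) j = pt o a₁ a₂ a₃ b (xsOf ps) j := pt_swapAt_0 o a₁ a₂ a₃ b ps
  have hle := lab_le ends o a₁ a₂ a₃ b (xsOf ps) ω 5
  have hs := lab_spec ends o a₁ a₂ a₃ b (xsOf ps) ω 6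
  -- the old label of the second end is an index of the common prefix
  have hj : lab ends o a₁ a₂ a₃ b (xsOf ps) ω 6 ≤ 4 := by omega
  have hnew : lab ends o a₁ a₂ a₃ b (xsOf (swapAt ps 0)) ω 5 ≤ lab ends o a₁ a₂ a₃ b (xsOf ps) ω 6 :=
    Nat.find_min' (p := fun j => Conn ends ω (pt o a₁ a₂ a₃ b (xsOf (swapAt ps 0)) j) (pt o a₁ a₂ a₃ b (xsOf (swapAt ps 0)) 5))
      ⟨5, conn_refl ends ω _⟩ (by rw [hpre _ hj]; simpa [swapAt] using hs)
  refine code8_lt_0 ends o a₁ a₂ a₃ b ω (xsOf ps) (xsOf (swapAt ps 0))  ?_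
  omega

/-- Swapping the ends of pair `1` changes no point before index `7`. -/
lemma pt_swapAt_1 (ps : Fin 4 → V × V) (j : ℕ) (hj : j ≤ 6) :
    pt o a₁ a₂ a₃ b (xsOf (swapAt ps 1)) j = pt o a₁ a₂ a₃ b (xsOf ps) j := by
  interval_cases j <;> rfl

/-- **Swapping a misoriented pair lowers the code**: if the first end of pair `1` carries the
larger label, the swapped list has a smaller code. -/
lemma code8_swapAt_lt_1 (ps : Fin 4 → V × V)
    (h : lab ends o a₁ a₂ a₃ b (xsOf ps) ω 8 < lab ends o a₁ a₂ a₃ b (xsOf ps) ω 7) :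
    code8 ends o a₁ a₂ a₃ b ω (xsOf (swapAt ps 1)) < code8 ends o a₁ a₂ a₃ b ω (xsOf ps) := by
  have hpre : ∀ j ≤ 6, pt o a₁ a₂ a₃ b (xsOf (swapAt ps 1)) j = pt o a₁ a₂ a₃ b (xsOf ps) j := pt_swapAt_1 o a₁ a₂ a₃ b ps
  have hle := lab_le ends o a₁ a₂ a₃ b (xsOf ps) ω 7
  have hs := lab_spec ends o a₁ a₂ a₃ b (xsOf ps) ω 8
  -- the old label of the second end is an index of the common prefix
  have hj : lab ends o a₁ a₂ a₃ b (xsOf ps) ω 8 ≤ 6 := by omega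
  have hnew : lab ends o a₁ a₂ a₃ b (xsOf (swapAt ps 1)) ω 7 ≤ lab ends o a₁ a₂ a₃ b (xsOf ps) ω 8 :=
    Nat.find_min' (p := fun j => Conn ends ω (pt o a₁ a₂ a₃ b (xsOf (swapAt ps 1)) j) (pt o a₁ a₂ a₃ b (xsOf (swapAt ps 1)) 7))
      ⟨7, conn_refl ends ω _⟩ (by rw [hpre _ hj]; simpa [swapAt] using hs)
  refine code8_lt_2 ends o a₁ a₂ a₃ b ω (xsOf ps) (xsOf (swapAt ps 1)) (lab_prefix ends o a₁ a₂ a₃ b _ _ ω 5 (fun i hi => hpre i (by omega))) (lab_prefix ends o a₁ a₂ a₃ b _ _ ω 6 (fun i hi => hpre i (by omega))) ?_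
  omega

/-- Swapping the ends of pair `2` changes no point before index `9`. -/
lemma pt_swapAt_2 (ps : Fin 4 → V × V) (j : ℕ) (hj : j ≤ 8) :
    pt o a₁ a₂ a₃ b (xsOf (swapAt ps 2)) j = pt o a₁ a₂ a₃ b (xsOf ps) j := by
  interval_cases j <;> rfl

/-- **Swapping a misoriented pair lowers the code**: if the first end of pair `2` carries the
larger label, the swapped list has a smaller code. -/
lemma code8_swapAt_lt_2 (ps : Fin 4 → V × V)
    (h : lab ends o a₁ a₂ a₃ b (xsOf ps) ω 10 < lab ends o a₁ a₂ a₃ b (xsOf ps) ω 9) :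
    code8 ends o a₁ a₂ a₃ b ω (xsOf (swapAt ps 2)) < code8 ends o a₁ a₂ a₃ b ω (xsOf ps) := by
  have hpre : ∀ j ≤ 8, pt o a₁ a₂ a₃ b (xsOf (swapAt ps 2)) j = pt o a₁ a₂ a₃ b (xsOf ps) j := pt_swapAt_2 o a₁ a₂ a₃ b ps
  have hle := lab_le ends o a₁ a₂ a₃ b (xsOf ps) ω 9
  have hs := lab_spec ends o a₁ a₂ a₃ b (xsOf ps) ω 10
  -- the old label of the second end is an index of the common prefix
  have hj : lab ends o a₁ a₂ a₃ b (xsOf ps) ω 10 ≤ 8 := by omega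
  have hnew : lab ends o a₁ a₂ a₃ b (xsOf (swapAt ps 2)) ω 9 ≤ lab ends o a₁ a₂ a₃ b (xsOf ps) ω 10 :=
    Nat.find_min' (p := fun j => Conn ends ω (pt o a₁ a₂ a₃ b (xsOf (swapAt ps 2)) j) (pt o a₁ a₂ a₃ b (xsOf (swapAt ps 2)) 9))
      ⟨9, conn_refl ends ω _⟩ (by rw [hpre _ hj]; simpa [swapAt] using hs)
  refine code8_lt_4 ends o a₁ a₂ a₃ b ω (xsOf ps) (xsOf (swapAt ps 2)) (lab_prefix ends o a₁ a₂ a₃ b _ _ ω 5 (fun i hi => hpre i (by omega))) (lab_prefix ends o a₁ a₂ a₃ b _ _ ω 6 (fun i hi => hpre i (by omega))) (lab_prefix ends o a₁ a₂ a₃ b _ _ ω 7 (fun i hi => hpre i (by omega))) (lab_prefix ends o a₁ a₂ a₃ b _ _ ω 8 (fun i hi => hpre i (by omega))) ?_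
  omega

/-- Swapping the ends of pair `3` changes no point before index `11`. -/
lemma pt_swapAt_3 (ps : Fin 4 → V × V) (j : ℕ) (hj : j ≤ 10) :
    pt o a₁ a₂ a₃ b (xsOf (swapAt ps 3)) j = pt o a₁ a₂ a₃ b (xsOf ps) j := by
  interval_cases j <;> rfl

/-- **Swapping a misoriented pair lowers the code**: if the first end of pair `3` carries the
larger label, the swapped list has a smaller code. -/
lemma code8_swapAt_lt_3 (ps : Fin 4 → V × V)
    (h : lab ends o a₁ a₂ a₃ b (xsOf ps) ω 12 < lab ends o a₁ a₂ a₃ b (xsOf ps) ω 11) :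
    code8 ends o a₁ a₂ a₃ b ω (xsOf (swapAt ps 3)) < code8 ends o a₁ a₂ a₃ b ω (xsOf ps) := by
  have hpre : ∀ j ≤ 10, pt o a₁ a₂ a₃ b (xsOf (swapAt ps 3)) j = pt o a₁ a₂ a₃ b (xsOf ps) j := pt_swapAt_3 o a₁ a₂ a₃ b ps
  have hle := lab_le ends o a₁ a₂ a₃ b (xsOf ps) ω 11
  have hs := lab_spec ends o a₁ a₂ a₃ b (xsOf ps) ω 12
  -- the old label of the second end is an index of the common prefix
  have hj : lab ends o a₁ a₂ a₃ b (xsOf ps) ω 12 ≤ 10 := by omega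
  have hnew : lab ends o a₁ a₂ a₃ b (xsOf (swapAt ps 3)) ω 11 ≤ lab ends o a₁ a₂ a₃ b (xsOf ps) ω 12 :=
    Nat.find_min' (p := fun j => Conn ends ω (pt o a₁ a₂ a₃ b (xsOf (swapAt ps 3)) j) (pt o a₁ a₂ a₃ b (xsOf (swapAt ps 3)) 11))
      ⟨11, conn_refl ends ω _⟩ (by rw [hpre _ hj]; simpa [swapAt] using hs)
  refine code8_lt_6 ends o a₁ a₂ a₃ b ω (xsOf ps) (xsOf (swapAt ps 3)) (lab_prefix ends o a₁ a₂ a₃ b _ _ ω 5 (fun i hi => hpre i (by omega))) (lab_prefix ends o a₁ a₂ a₃ b _ _ ω 6 (fun i hi => hpre i (by omega))) (lab_prefix ends o a₁ a₂ a₃ b _ _ ω 7 (fun i hi => hpre i (by omega))) (lab_prefix ends o a₁ a₂ a₃ b _ _ ω 8 (fun i hi => hpre i (by omega))) (lab_prefix ends o a₁ a₂ a₃ b _ _ ω 9 (fun i hi => hpre i (by omega))) (lab_prefix ends o a₁ a₂ a₃ b _ _ ω 10 (fun i hi => hpre i (by omega))) ?_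
  omega

/-- Exchanging pairs `0` and `1` changes no point before index `5`. -/
lemma pt_exch_0 (ps : Fin 4 → V × V) (j : ℕ) (hj : j ≤ 4) :
    pt o a₁ a₂ a₃ b (xsOf (exch ps 0)) j = pt o a₁ a₂ a₃ b (xsOf ps) j := by
  interval_cases j <;> rfl

/-- **Exchanging two misordered pairs lowers the code**: if pair `1` is lexicographically
smaller than pair `0`, the exchanged list has a smaller code. -/
lemma code8_exch_lt_0 (ps : Fin 4 → V × V)
    (h : lab ends o a₁ a₂ a₃ b (xsOf ps) ω 7 < lab ends o a₁ a₂ a₃ b (xsOf ps) ω 5 ∨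
      (lab ends o a₁ a₂ a₃ b (xsOf ps) ω 7 = lab ends o a₁ a₂ a₃ b (xsOf ps) ω 5 ∧ lab ends o a₁ a₂ a₃ b (xsOf ps) ω 8 < lab ends o a₁ a₂ a₃ b (xsOf ps) ω 6)) :
    code8 ends o a₁ a₂ a₃ b ω (xsOf (exch ps 0)) < code8 ends o a₁ a₂ a₃ b ω (xsOf ps) := by
  have hpre : ∀ j ≤ 4, pt o a₁ a₂ a₃ b (xsOf (exch ps 0)) j = pt o a₁ a₂ a₃ b (xsOf ps) j := pt_exch_0 o a₁ a₂ a₃ b ps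
  have hleP := lab_le ends o a₁ a₂ a₃ b (xsOf ps) ω 5
  have hleP1 := lab_le ends o a₁ a₂ a₃ b (xsOf ps) ω 6
  have hs2 := lab_spec ends o a₁ a₂ a₃ b (xsOf ps) ω 7
  have hs3 := lab_spec ends o a₁ a₂ a₃ b (xsOf ps) ω 8
  have hmin2 : ∀ n, n < lab ends o a₁ a₂ a₃ b (xsOf ps) ω 7 → ¬ Conn ends ω (pt o a₁ a₂ a₃ b (xsOf ps) n) (pt o a₁ a₂ a₃ b (xsOf ps) 7) :=
    fun n hn => Nat.find_min (⟨7, conn_refl ends ω (pt o a₁ a₂ a₃ b (xsOf ps) 7)⟩ :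
      ∃ j, Conn ends ω (pt o a₁ a₂ a₃ b (xsOf ps) j) (pt o a₁ a₂ a₃ b (xsOf ps) 7)) hn
  rcases h with hA | ⟨hB1, hB2⟩
  · -- case A: the first end of pair `1` has the smaller label
    have hj : lab ends o a₁ a₂ a₃ b (xsOf ps) ω 7 ≤ 4 := by omega
    have hnew : lab ends o a₁ a₂ a₃ b (xsOf (exch ps 0)) ω 5 ≤ lab ends o a₁ a₂ a₃ b (xsOf ps) ω 7 :=
      Nat.find_min' (p := fun j => Conn ends ω (pt o a₁ a₂ a₃ b (xsOf (exch ps 0)) j) (pt o a₁ a₂ a₃ b (xsOf (exch ps 0)) 5))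
        ⟨5, conn_refl ends ω _⟩ (by rw [hpre _ hj]; simpa [exch] using hs2)
    refine code8_lt_0 ends o a₁ a₂ a₃ b ω (xsOf ps) (xsOf (exch ps 0))  ?_
    omega
  · -- case B: equal first labels, the second end of pair `1` has the smaller label
    have hv : lab ends o a₁ a₂ a₃ b (xsOf (exch ps 0)) ω 5 = lab ends o a₁ a₂ a₃ b (xsOf ps) ω 5 := by
      apply le_antisymm
      · rcases Nat.lt_or_ge (lab ends o a₁ a₂ a₃ b (xsOf ps) ω 5) 5 with hlt | hge
        · refine Nat.find_min' (p := fun j => Conn ends ω (pt o a₁ a₂ a₃ b (xsOf (exch ps 0)) j) (pt o a₁ a₂ a₃ b (xsOf (exch ps 0)) 5))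
            ⟨5, conn_refl ends ω _⟩ ?_
          rw [hpre _ (by omega), ← hB1]
          simpa [exch] using hs2
        · have := lab_le ends o a₁ a₂ a₃ b (xsOf (exch ps 0)) ω 5
          omega
      · by_contra hlt
        simp only [not_le] at hlt
        have hs' := lab_spec ends o a₁ a₂ a₃ b (xsOf (exch ps 0)) ω 5
        rw [hpre _ (by omega)] at hs'
        exact hmin2 (lab ends o a₁ a₂ a₃ b (xsOf (exch ps 0)) ω 5) (by omega) (by simpa [exch] using hs')
    have hnew : lab ends o a₁ a₂ a₃ b (xsOf (exch ps 0)) ω 6 < lab ends o a₁ a₂ a₃ b (xsOf ps) ω 6 := by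
      rcases Nat.lt_or_ge (lab ends o a₁ a₂ a₃ b (xsOf ps) ω 8) 5 with hlt | hge
      · have : lab ends o a₁ a₂ a₃ b (xsOf (exch ps 0)) ω 6 ≤ lab ends o a₁ a₂ a₃ b (xsOf ps) ω 8 :=
          Nat.find_min' (p := fun j => Conn ends ω (pt o a₁ a₂ a₃ b (xsOf (exch ps 0)) j) (pt o a₁ a₂ a₃ b (xsOf (exch ps 0)) 6))
            ⟨6, conn_refl ends ω _⟩ (by rw [hpre _ (by omega)]; simpa [exch] using hs3)
        omega
      · -- the second end of pair `1` is joined to the first end of pair `0`, hence to its own first end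
        have hj3 : lab ends o a₁ a₂ a₃ b (xsOf ps) ω 8 = 5 := by omega
        rw [hj3] at hs3
        have hpp : Conn ends ω (pt o a₁ a₂ a₃ b (xsOf ps) 5) (pt o a₁ a₂ a₃ b (xsOf ps) 7) :=
          (lab_eq_iff ends o a₁ a₂ a₃ b (xsOf ps) ω 5 7).mp hB1.symm
        have : lab ends o a₁ a₂ a₃ b (xsOf (exch ps 0)) ω 6 ≤ 5 :=
          Nat.find_min' (p := fun j => Conn ends ω (pt o a₁ a₂ a₃ b (xsOf (exch ps 0)) j) (pt o a₁ a₂ a₃ b (xsOf (exch ps 0)) 6))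
            ⟨6, conn_refl ends ω _⟩ (by simpa [exch] using conn_trans (conn_symm hpp) hs3)
        omega
    refine code8_lt_1 ends o a₁ a₂ a₃ b ω (xsOf ps) (xsOf (exch ps 0))  hv ?_
    exact hnew

/-- Exchanging pairs `1` and `2` changes no point before index `7`. -/
lemma pt_exch_1 (ps : Fin 4 → V × V) (j : ℕ) (hj : j ≤ 6) :
    pt o a₁ a₂ a₃ b (xsOf (exch ps 1)) j = pt o a₁ a₂ a₃ b (xsOf ps) j := by
  interval_cases j <;> rfl

/-- **Exchanging two misordered pairs lowers the code**: if pair `2` is lexicographically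
smaller than pair `1`, the exchanged list has a smaller code. -/
lemma code8_exch_lt_1 (ps : Fin 4 → V × V)
    (h : lab ends o a₁ a₂ a₃ b (xsOf ps) ω 9 < lab ends o a₁ a₂ a₃ b (xsOf ps) ω 7 ∨
      (lab ends o a₁ a₂ a₃ b (xsOf ps) ω 9 = lab ends o a₁ a₂ a₃ b (xsOf ps) ω 7 ∧ lab ends o a₁ a₂ a₃ b (xsOf ps) ω 10 < lab ends o a₁ a₂ a₃ b (xsOf ps) ω 8)) :
    code8 ends o a₁ a₂ a₃ b ω (xsOf (exch ps 1)) < code8 ends o a₁ a₂ a₃ b ω (xsOf ps) := by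
  have hpre : ∀ j ≤ 6, pt o a₁ a₂ a₃ b (xsOf (exch ps 1)) j = pt o a₁ a₂ a₃ b (xsOf ps) j := pt_exch_1 o a₁ a₂ a₃ b ps
  have hleP := lab_le ends o a₁ a₂ a₃ b (xsOf ps) ω 7
  have hleP1 := lab_le ends o a₁ a₂ a₃ b (xsOf ps) ω 8
  have hs2 := lab_spec ends o a₁ a₂ a₃ b (xsOf ps) ω 9
  have hs3 := lab_spec ends o a₁ a₂ a₃ b (xsOf ps) ω 10
  have hmin2 : ∀ n, n < lab ends o a₁ a₂ a₃ b (xsOf ps) ω 9 → ¬ Conn ends ω (pt o a₁ a₂ a₃ b (xsOf ps) n) (pt o a₁ a₂ a₃ b (xsOf ps) 9) :=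
    fun n hn => Nat.find_min (⟨9, conn_refl ends ω (pt o a₁ a₂ a₃ b (xsOf ps) 9)⟩ :
      ∃ j, Conn ends ω (pt o a₁ a₂ a₃ b (xsOf ps) j) (pt o a₁ a₂ a₃ b (xsOf ps) 9)) hn
  rcases h with hA | ⟨hB1, hB2⟩
  · -- case A: the first end of pair `2` has the smaller label
    have hj : lab ends o a₁ a₂ a₃ b (xsOf ps) ω 9 ≤ 6 := by omega
    have hnew : lab ends o a₁ a₂ a₃ b (xsOf (exch ps 1)) ω 7 ≤ lab ends o a₁ a₂ a₃ b (xsOf ps) ω 9 :=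
      Nat.find_min' (p := fun j => Conn ends ω (pt o a₁ a₂ a₃ b (xsOf (exch ps 1)) j) (pt o a₁ a₂ a₃ b (xsOf (exch ps 1)) 7))
        ⟨7, conn_refl ends ω _⟩ (by rw [hpre _ hj]; simpa [exch] using hs2)
    refine code8_lt_2 ends o a₁ a₂ a₃ b ω (xsOf ps) (xsOf (exch ps 1)) (lab_prefix ends o a₁ a₂ a₃ b _ _ ω 5 (fun i hi => hpre i (by omega))) (lab_prefix ends o a₁ a₂ a₃ b _ _ ω 6 (fun i hi => hpre i (by omega))) ?_
    omega
  · -- case B: equal first labels, the second end of pair `2` has the smaller label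
    have hv : lab ends o a₁ a₂ a₃ b (xsOf (exch ps 1)) ω 7 = lab ends o a₁ a₂ a₃ b (xsOf ps) ω 7 := by
      apply le_antisymm
      · rcases Nat.lt_or_ge (lab ends o a₁ a₂ a₃ b (xsOf ps) ω 7) 7 with hlt | hge
        · refine Nat.find_min' (p := fun j => Conn ends ω (pt o a₁ a₂ a₃ b (xsOf (exch ps 1)) j) (pt o a₁ a₂ a₃ b (xsOf (exch ps 1)) 7))
            ⟨7, conn_refl ends ω _⟩ ?_
          rw [hpre _ (by omega), ← hB1]
          simpa [exch] using hs2
        · have := lab_le ends o a₁ a₂ a₃ b (xsOf (exch ps 1)) ω 7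
          omega
      · by_contra hlt
        simp only [not_le] at hlt
        have hs' := lab_spec ends o a₁ a₂ a₃ b (xsOf (exch ps 1)) ω 7
        rw [hpre _ (by omega)] at hs'
        exact hmin2 (lab ends o a₁ a₂ a₃ b (xsOf (exch ps 1)) ω 7) (by omega) (by simpa [exch] using hs')
    have hnew : lab ends o a₁ a₂ a₃ b (xsOf (exch ps 1)) ω 8 < lab ends o a₁ a₂ a₃ b (xsOf ps) ω 8 := by
      rcases Nat.lt_or_ge (lab ends o a₁ a₂ a₃ b (xsOf ps) ω 10) 7 with hlt | hge
      · have : lab ends o a₁ a₂ a₃ b (xsOf (exch ps 1)) ω 8 ≤ lab ends o a₁ a₂ a₃ b (xsOf ps) ω 10 :=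
          Nat.find_min' (p := fun j => Conn ends ω (pt o a₁ a₂ a₃ b (xsOf (exch ps 1)) j) (pt o a₁ a₂ a₃ b (xsOf (exch ps 1)) 8))
            ⟨8, conn_refl ends ω _⟩ (by rw [hpre _ (by omega)]; simpa [exch] using hs3)
        omega
      · -- the second end of pair `2` is joined to the first end of pair `1`, hence to its own first end
        have hj3 : lab ends o a₁ a₂ a₃ b (xsOf ps) ω 10 = 7 := by omega
        rw [hj3] at hs3
        have hpp : Conn ends ω (pt o a₁ a₂ a₃ b (xsOf ps) 7) (pt o a₁ a₂ a₃ b (xsOf ps) 9) :=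
          (lab_eq_iff ends o a₁ a₂ a₃ b (xsOf ps) ω 7 9).mp hB1.symm
        have : lab ends o a₁ a₂ a₃ b (xsOf (exch ps 1)) ω 8 ≤ 7 :=
          Nat.find_min' (p := fun j => Conn ends ω (pt o a₁ a₂ a₃ b (xsOf (exch ps 1)) j) (pt o a₁ a₂ a₃ b (xsOf (exch ps 1)) 8))
            ⟨8, conn_refl ends ω _⟩ (by simpa [exch] using conn_trans (conn_symm hpp) hs3)
        omega
    refine code8_lt_3 ends o a₁ a₂ a₃ b ω (xsOf ps) (xsOf (exch ps 1)) (lab_prefix ends o a₁ a₂ a₃ b _ _ ω 5 (fun i hi => hpre i (by omega))) (lab_prefix ends o a₁ a₂ a₃ b _ _ ω 6 (fun i hi => hpre i (by omega))) hv ?_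
    exact hnew

/-- Exchanging pairs `2` and `3` changes no point before index `9`. -/
lemma pt_exch_2 (ps : Fin 4 → V × V) (j : ℕ) (hj : j ≤ 8) :
    pt o a₁ a₂ a₃ b (xsOf (exch ps 2)) j = pt o a₁ a₂ a₃ b (xsOf ps) j := by
  interval_cases j <;> rfl

/-- **Exchanging two misordered pairs lowers the code**: if pair `3` is lexicographically
smaller than pair `2`, the exchanged list has a smaller code. -/
lemma code8_exch_lt_2 (ps : Fin 4 → V × V)
    (h : lab ends o a₁ a₂ a₃ b (xsOf ps) ω 11 < lab ends o a₁ a₂ a₃ b (xsOf ps) ω 9 ∨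
      (lab ends o a₁ a₂ a₃ b (xsOf ps) ω 11 = lab ends o a₁ a₂ a₃ b (xsOf ps) ω 9 ∧ lab ends o a₁ a₂ a₃ b (xsOf ps) ω 12 < lab ends o a₁ a₂ a₃ b (xsOf ps) ω 10)) :
    code8 ends o a₁ a₂ a₃ b ω (xsOf (exch ps 2)) < code8 ends o a₁ a₂ a₃ b ω (xsOf ps) := by
  have hpre : ∀ j ≤ 8, pt o a₁ a₂ a₃ b (xsOf (exch ps 2)) j = pt o a₁ a₂ a₃ b (xsOf ps) j := pt_exch_2 o a₁ a₂ a₃ b ps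
  have hleP := lab_le ends o a₁ a₂ a₃ b (xsOf ps) ω 9
  have hleP1 := lab_le ends o a₁ a₂ a₃ b (xsOf ps) ω 10
  have hs2 := lab_spec ends o a₁ a₂ a₃ b (xsOf ps) ω 11
  have hs3 := lab_spec ends o a₁ a₂ a₃ b (xsOf ps) ω 12
  have hmin2 : ∀ n, n < lab ends o a₁ a₂ a₃ b (xsOf ps) ω 11 → ¬ Conn ends ω (pt o a₁ a₂ a₃ b (xsOf ps) n) (pt o a₁ a₂ a₃ b (xsOf ps) 11) :=
    fun n hn => Nat.find_min (⟨11, conn_refl ends ω (pt o a₁ a₂ a₃ b (xsOf ps) 11)⟩ :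
      ∃ j, Conn ends ω (pt o a₁ a₂ a₃ b (xsOf ps) j) (pt o a₁ a₂ a₃ b (xsOf ps) 11)) hn
  rcases h with hA | ⟨hB1, hB2⟩
  · -- case A: the first end of pair `3` has the smaller label
    have hj : lab ends o a₁ a₂ a₃ b (xsOf ps) ω 11 ≤ 8 := by omega
    have hnew : lab ends o a₁ a₂ a₃ b (xsOf (exch ps 2)) ω 9 ≤ lab ends o a₁ a₂ a₃ b (xsOf ps) ω 11 :=
      Nat.find_min' (p := fun j => Conn ends ω (pt o a₁ a₂ a₃ b (xsOf (exch ps 2)) j) (pt o a₁ a₂ a₃ b (xsOf (exch ps 2)) 9))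
        ⟨9, conn_refl ends ω _⟩ (by rw [hpre _ hj]; simpa [exch] using hs2)
    refine code8_lt_4 ends o a₁ a₂ a₃ b ω (xsOf ps) (xsOf (exch ps 2)) (lab_prefix ends o a₁ a₂ a₃ b _ _ ω 5 (fun i hi => hpre i (by omega))) (lab_prefix ends o a₁ a₂ a₃ b _ _ ω 6 (fun i hi => hpre i (by omega))) (lab_prefix ends o a₁ a₂ a₃ b _ _ ω 7 (fun i hi => hpre i (by omega))) (lab_prefix ends o a₁ a₂ a₃ b _ _ ω 8 (fun i hi => hpre i (by omega))) ?_
    omega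
  · -- case B: equal first labels, the second end of pair `3` has the smaller label
    have hv : lab ends o a₁ a₂ a₃ b (xsOf (exch ps 2)) ω 9 = lab ends o a₁ a₂ a₃ b (xsOf ps) ω 9 := by
      apply le_antisymm
      · rcases Nat.lt_or_ge (lab ends o a₁ a₂ a₃ b (xsOf ps) ω 9) 9 with hlt | hge
        · refine Nat.find_min' (p := fun j => Conn ends ω (pt o a₁ a₂ a₃ b (xsOf (exch ps 2)) j) (pt o a₁ a₂ a₃ b (xsOf (exch ps 2)) 9))
            ⟨9, conn_refl ends ω _⟩ ?_
          rw [hpre _ (by omega), ← hB1]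
          simpa [exch] using hs2
        · have := lab_le ends o a₁ a₂ a₃ b (xsOf (exch ps 2)) ω 9
          omega
      · by_contra hlt
        simp only [not_le] at hlt
        have hs' := lab_spec ends o a₁ a₂ a₃ b (xsOf (exch ps 2)) ω 9
        rw [hpre _ (by omega)] at hs'
        exact hmin2 (lab ends o a₁ a₂ a₃ b (xsOf (exch ps 2)) ω 9) (by omega) (by simpa [exch] using hs')
    have hnew : lab ends o a₁ a₂ a₃ b (xsOf (exch ps 2)) ω 10 < lab ends o a₁ a₂ a₃ b (xsOf ps) ω 10 := by
      rcases Nat.lt_or_ge (lab ends o a₁ a₂ a₃ b (xsOf ps) ω 12) 9 with hlt | hge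
      · have : lab ends o a₁ a₂ a₃ b (xsOf (exch ps 2)) ω 10 ≤ lab ends o a₁ a₂ a₃ b (xsOf ps) ω 12 :=
          Nat.find_min' (p := fun j => Conn ends ω (pt o a₁ a₂ a₃ b (xsOf (exch ps 2)) j) (pt o a₁ a₂ a₃ b (xsOf (exch ps 2)) 10))
            ⟨10, conn_refl ends ω _⟩ (by rw [hpre _ (by omega)]; simpa [exch] using hs3)
        omega
      · -- the second end of pair `3` is joined to the first end of pair `2`, hence to its own first end
        have hj3 : lab ends o a₁ a₂ a₃ b (xsOf ps) ω 12 = 9 := by omega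
        rw [hj3] at hs3
        have hpp : Conn ends ω (pt o a₁ a₂ a₃ b (xsOf ps) 9) (pt o a₁ a₂ a₃ b (xsOf ps) 11) :=
          (lab_eq_iff ends o a₁ a₂ a₃ b (xsOf ps) ω 9 11).mp hB1.symm
        have : lab ends o a₁ a₂ a₃ b (xsOf (exch ps 2)) ω 10 ≤ 9 :=
          Nat.find_min' (p := fun j => Conn ends ω (pt o a₁ a₂ a₃ b (xsOf (exch ps 2)) j) (pt o a₁ a₂ a₃ b (xsOf (exch ps 2)) 10))
            ⟨10, conn_refl ends ω _⟩ (by simpa [exch] using conn_trans (conn_symm hpp) hs3)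
        omega
    refine code8_lt_5 ends o a₁ a₂ a₃ b ω (xsOf ps) (xsOf (exch ps 2)) (lab_prefix ends o a₁ a₂ a₃ b _ _ ω 5 (fun i hi => hpre i (by omega))) (lab_prefix ends o a₁ a₂ a₃ b _ _ ω 6 (fun i hi => hpre i (by omega))) (lab_prefix ends o a₁ a₂ a₃ b _ _ ω 7 (fun i hi => hpre i (by omega))) (lab_prefix ends o a₁ a₂ a₃ b _ _ ω 8 (fun i hi => hpre i (by omega))) hv ?_
    exact hnew

/-- Toggling the swap flag of pair `k` swaps its ends in the acted list. -/
lemma act_update (σ : Equiv.Perm (Fin 4)) (fl : Fin 4 → Bool) (ps : Fin 4 → V × V) (k : Fin 4) :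
    act σ (Function.update fl k (!fl k)) ps = swapAt (act σ fl ps) k := by
  funext i
  by_cases hi : i = k
  · subst hi
    simp only [act, swapAt, Function.update_self]
    cases fl i <;> simp
  · simp only [act, swapAt, Function.update_of_ne hi]

/-- Composing with the transposition of `k` and `k + 1` exchanges the two pairs in the acted list. -/
lemma act_swap (σ : Equiv.Perm (Fin 4)) (fl : Fin 4 → Bool) (ps : Fin 4 → V × V) (k : Fin 4) :
    act ((Equiv.swap k (k + 1)).trans σ) (fl ∘ Equiv.swap k (k + 1)) ps = exch (act σ fl ps) k := by
  funext i
  simp only [act, exch, Equiv.trans_apply, Function.comp]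

/-- **Every list of four pairs has a sorted member in its orbit**: the member of least code
under pair permutations and end swaps is sorted. -/
theorem exists_sorted (ps : Fin 4 → V × V) :
    ∃ (σ : Equiv.Perm (Fin 4)) (fl : Fin 4 → Bool), Sorted8 ends o a₁ a₂ a₃ b ω (act σ fl ps) := by
  obtain ⟨g, -, hmin⟩ := Finset.exists_min_image Finset.univ
    (fun g : Equiv.Perm (Fin 4) × (Fin 4 → Bool) => code8 ends o a₁ a₂ a₃ b ω (xsOf (act g.1 g.2 ps)))
    Finset.univ_nonempty
  refine ⟨g.1, g.2, ?_, ?_, ?_, ?_, ?_, ?_, ?_⟩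
  · by_contra h
    simp only [not_le] at h
    have hm := hmin (g.1, Function.update g.2 0 (!g.2 0)) (Finset.mem_univ _)
    simp only [act_update] at hm
    exact absurd (code8_swapAt_lt_0 ends o a₁ a₂ a₃ b ω _ h) (not_lt.mpr hm)
  · by_contra h
    simp only [not_le] at h
    have hm := hmin (g.1, Function.update g.2 1 (!g.2 1)) (Finset.mem_univ _)
    simp only [act_update] at hm
    exact absurd (code8_swapAt_lt_1 ends o a₁ a₂ a₃ b ω _ h) (not_lt.mpr hm)
  · by_contra h
    simp only [not_le] at h
    have hm := hmin (g.1, Function.update g.2 2 (!g.2 2)) (Finset.mem_univ _)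
    simp only [act_update] at hm
    exact absurd (code8_swapAt_lt_2 ends o a₁ a₂ a₃ b ω _ h) (not_lt.mpr hm)
  · by_contra h
    simp only [not_le] at h
    have hm := hmin (g.1, Function.update g.2 3 (!g.2 3)) (Finset.mem_univ _)
    simp only [act_update] at hm
    exact absurd (code8_swapAt_lt_3 ends o a₁ a₂ a₃ b ω _ h) (not_lt.mpr hm)
  · by_contra h
    have h' : lab ends o a₁ a₂ a₃ b (xsOf (act g.1 g.2 ps)) ω 7 < lab ends o a₁ a₂ a₃ b (xsOf (act g.1 g.2 ps)) ω 5 ∨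
        (lab ends o a₁ a₂ a₃ b (xsOf (act g.1 g.2 ps)) ω 7 = lab ends o a₁ a₂ a₃ b (xsOf (act g.1 g.2 ps)) ω 5 ∧
          lab ends o a₁ a₂ a₃ b (xsOf (act g.1 g.2 ps)) ω 8 < lab ends o a₁ a₂ a₃ b (xsOf (act g.1 g.2 ps)) ω 6) := by
      simp only [not_or, not_lt, not_and] at h
      omega
    have hm := hmin ((Equiv.swap (0 : Fin 4) (0 + 1)).trans g.1, g.2 ∘ Equiv.swap (0 : Fin 4) (0 + 1)) (Finset.mem_univ _)
    simp only [act_swap] at hm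
    exact absurd (code8_exch_lt_0 ends o a₁ a₂ a₃ b ω _ h') (not_lt.mpr hm)
  · by_contra h
    have h' : lab ends o a₁ a₂ a₃ b (xsOf (act g.1 g.2 ps)) ω 9 < lab ends o a₁ a₂ a₃ b (xsOf (act g.1 g.2 ps)) ω 7 ∨
        (lab ends o a₁ a₂ a₃ b (xsOf (act g.1 g.2 ps)) ω 9 = lab ends o a₁ a₂ a₃ b (xsOf (act g.1 g.2 ps)) ω 7 ∧
          lab ends o a₁ a₂ a₃ b (xsOf (act g.1 g.2 ps)) ω 10 < lab ends o a₁ a₂ a₃ b (xsOf (act g.1 g.2 ps)) ω 8) := by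
      simp only [not_or, not_lt, not_and] at h
      omega
    have hm := hmin ((Equiv.swap (1 : Fin 4) (1 + 1)).trans g.1, g.2 ∘ Equiv.swap (1 : Fin 4) (1 + 1)) (Finset.mem_univ _)
    simp only [act_swap] at hm
    exact absurd (code8_exch_lt_1 ends o a₁ a₂ a₃ b ω _ h') (not_lt.mpr hm)
  · by_contra h
    have h' : lab ends o a₁ a₂ a₃ b (xsOf (act g.1 g.2 ps)) ω 11 < lab ends o a₁ a₂ a₃ b (xsOf (act g.1 g.2 ps)) ω 9 ∨
        (lab ends o a₁ a₂ a₃ b (xsOf (act g.1 g.2 ps)) ω 11 = lab ends o a₁ a₂ a₃ b (xsOf (act g.1 g.2 ps)) ω 9 ∧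
          lab ends o a₁ a₂ a₃ b (xsOf (act g.1 g.2 ps)) ω 12 < lab ends o a₁ a₂ a₃ b (xsOf (act g.1 g.2 ps)) ω 10) := by
      simp only [not_or, not_lt, not_and] at h
      omega
    have hm := hmin ((Equiv.swap (2 : Fin 4) (2 + 1)).trans g.1, g.2 ∘ Equiv.swap (2 : Fin 4) (2 + 1)) (Finset.mem_univ _)
    simp only [act_swap] at hm
    exact absurd (code8_exch_lt_2 ends o a₁ a₂ a₃ b ω _ h') (not_lt.mpr hm)

end Sorted

end TwoTyped

end CovForm

end Summit.Ventures.PercRepro2
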